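import Summits.AnomalousDissipation.AnomalousDissipation.Theorems.SolenoidalFractalHomogenisationLagrangianStepCellLawVOddGainDefectAutocorr
import Literature.Analysis.Fourier.FractalUncertaintyFourierTools
import HarnessLib

/-!
# K1L `LagrangianRenormalisationStep(Design)` (K1L_D, stmt-AnomalousDissipation-27980; aside 24912), stub `stub_cellLawV0_IS`
# — W5 odd half, branch B of D24-16 (exact sector non-expansion of `f_T(B)`): PART 2/4 — the SPECTRAL side: `𝓕A = |𝓕a|²` explicitly and Fourier inversion `A(u) = (1/π)∫₀^∞ Â_ρ(η)cos(ηu)dη`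

(planner ad-ideate-p5 g8, lens «profile»; text byte-for-byte from the crux workfile `Cruxes/LagrangianRenormalisationStep/OddGainDefectAutocorr.lean`
v2 = crux write 8ce4ef592c1f, split for the 400-line cap; lander: `--kind proof --supports stmt-AnomalousDissipation-27980 --as helper`).
NOT a proof of the stub, of the crux, of Onsager's conjecture or of anomalous dissipation — rung-leaf F-D1.A0 analysis.  No named facts, no sorry.
* §12 `fourier_boxC(_mul_neg)`, `trapC_eq_smul_conv` (`a = ρ⁻¹𝟙_{[0,ρ]}⋆𝟙_{[0,1−ρ]}`, `0 < ρ ≤ 1/2`), `rampAutocorr_eq_conv`, **`fourier_rampAutocorrC`** (`𝓕A = trapSpec ρ`, `ξ ≠ 0`);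
* §13 `integrable_trapSpec`, **`rampAutocorr_eq_integral_trapSpec`**, `slotSpec`, **`rampAutocorr_eq_slotSpec_integral`** (Mathlib `Continuous.fourierInv_fourier_eq`).
Landed by prover ad-k3l-bookkeeping-p1 g5 from the planner's landing kit `HOME/ad-ideate-p5/k1l-odd-defect/split/` (bodies = crux text byte-for-byte;
gate-demanded one-line docstrings added; lint fixes: unused simp arg `indicator_apply` dropped, deprecated `bdd_mul'` → `bdd_mul`).
-/

set_option linter.dupNamespace false

namespace Summit.AnomalousDissipation.AnomalousDissipation.Theorems.SolenoidalFractalHomogenisation.LagrangianStep.OddGain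

open MeasureTheory Set Matrix Literature.Analysis Literature.Analysis.FluidPDE Literature.Analysis.FluidPDE.LatticeShear
open Literature.Analysis.ODE.PeriodicAveraging

/-! ## §12 Fourier side: boxes, `|𝓕 box|²`, the trapezoid as a box convolution, `𝓕` of the autocorrelation -/

section FourierSide

open scoped FourierTransform Convolution Real

/-- The box `𝟙_{[0, L]}` as a complex-valued function. [folklore] -/
noncomputable def boxC (L : ℝ) : ℝ → ℂ := (Icc (0:ℝ) L).indicator fun _ => (1:ℂ)

/-- The box is integrable. [folklore] -/
theorem integrable_boxC (L : ℝ) : Integrable (boxC L) :=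
  ((continuous_const (y := (1:ℂ))).continuousOn.integrableOn_compact isCompact_Icc).integrable_indicator
    measurableSet_Icc

/-- The Fourier transform of the box as an interval integral: `𝓕 𝟙_{[0,L]}(ξ) = ∫₀ᴸ e^{−2πiξt} dt`. [folklore] -/
theorem fourier_boxC_eq_intervalIntegral {L : ℝ} (hL : 0 ≤ L) (ξ : ℝ) :
    𝓕 (boxC L) ξ = ∫ t in (0:ℝ)..L, Complex.exp ((-2 * π * ξ * Complex.I) * t) := by
  rw [Real.fourier_real_eq_integral_exp_smul]
  have h : (fun v : ℝ => Complex.exp (↑(-2 * π * v * ξ) * Complex.I) • boxC L v) =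
      (Icc (0:ℝ) L).indicator (fun v : ℝ => Complex.exp ((-2 * π * ξ * Complex.I) * v)) := by
    funext v
    by_cases hv : v ∈ Icc (0:ℝ) L
    · rw [boxC, indicator_of_mem hv, indicator_of_mem hv, smul_eq_mul, mul_one]
      congr 1
      push_cast
      ring
    · rw [boxC, indicator_of_notMem hv, indicator_of_notMem hv, smul_zero]
  rw [h, integral_indicator measurableSet_Icc, integral_Icc_eq_integral_Ioc, ← intervalIntegral.integral_of_le hL]

/-- **The Fourier transform of the box** (`ξ ≠ 0`): `𝓕 𝟙_{[0,L]}(ξ) = (e^{−2πiξL} − 1)/(−2πiξ)`. [folklore] -/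
theorem fourier_boxC {L : ℝ} (hL : 0 ≤ L) {ξ : ℝ} (hξ : ξ ≠ 0) :
    𝓕 (boxC L) ξ = (Complex.exp ((-2 * π * ξ * Complex.I) * L) - 1) / (-2 * π * ξ * Complex.I) := by
  have hc : (-2 * π * ξ * Complex.I : ℂ) ≠ 0 := by
    have hπ : (π : ℂ) ≠ 0 := Complex.ofReal_ne_zero.2 Real.pi_ne_zero
    have hξ' : (ξ : ℂ) ≠ 0 := Complex.ofReal_ne_zero.2 hξ
    simp [hπ, hξ', Complex.I_ne_zero]
  rw [fourier_boxC_eq_intervalIntegral hL, integral_exp_mul_complex hc]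
  simp

/-- **`|𝓕 box|²`**: `𝓕 𝟙_{[0,L]}(ξ) · 𝓕 𝟙_{[0,L]}(−ξ) = sin²(πLξ)/(π²ξ²)` (`ξ ≠ 0`). [folklore] -/
theorem fourier_boxC_mul_neg {L : ℝ} (hL : 0 ≤ L) {ξ : ℝ} (hξ : ξ ≠ 0) :
    𝓕 (boxC L) ξ * 𝓕 (boxC L) (-ξ) = ((Real.sin (π * L * ξ) ^ 2 / (π ^ 2 * ξ ^ 2) : ℝ) : ℂ) := by
  rw [fourier_boxC hL hξ, fourier_boxC hL (neg_ne_zero.2 hξ), div_mul_div_comm]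
  have e1 : (-2 * π * ξ * Complex.I) * L = -((2 * π * L * ξ : ℝ) : ℂ) * Complex.I := by push_cast; ring
  have e2 : (-2 * π * ((-ξ : ℝ) : ℂ) * Complex.I) * L = ((2 * π * L * ξ : ℝ) : ℂ) * Complex.I := by push_cast; ring
  have num : (Complex.exp ((-2 * π * ξ * Complex.I) * L) - 1) * (Complex.exp ((-2 * π * ((-ξ : ℝ) : ℂ) * Complex.I) * L) - 1) =
      2 - 2 * Complex.cos ((2 * π * L * ξ : ℝ) : ℂ) := by
    rw [e1, e2]
    have hc := Complex.two_cos (((2 * π * L * ξ : ℝ) : ℂ))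
    have hprod : Complex.exp (-((2 * π * L * ξ : ℝ) : ℂ) * Complex.I) * Complex.exp (((2 * π * L * ξ : ℝ) : ℂ) * Complex.I) = 1 := by
      rw [← Complex.exp_add]; simp
    linear_combination hprod + hc
  have den : (-2 * π * ξ * Complex.I) * (-2 * π * ((-ξ : ℝ) : ℂ) * Complex.I) = 4 * (π : ℂ) ^ 2 * (ξ : ℂ) ^ 2 := by
    push_cast
    linear_combination (-4 * (π : ℂ) ^ 2 * (ξ : ℂ) ^ 2) * Complex.I_mul_I
  rw [num, den]
  have hπ : (π : ℂ) ≠ 0 := Complex.ofReal_ne_zero.2 Real.pi_ne_zero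
  have hξ' : (ξ : ℂ) ≠ 0 := Complex.ofReal_ne_zero.2 hξ
  push_cast
  rw [show (2 : ℂ) * ↑π * ↑L * ↑ξ = 2 * (↑π * ↑L * ↑ξ) by ring, Complex.cos_two_mul, Complex.cos_sq']
  field_simp
  ring

/-- `𝟙_{[0,L]}(x − t) = 𝟙_{[x−L, x]}(t)`. [folklore] -/
theorem boxC_sub (L x t : ℝ) : boxC L (x - t) = (Icc (x - L) x).indicator (fun _ => (1:ℂ)) t := by
  unfold boxC
  by_cases h : t ∈ Icc (x - L) x
  · have h' : x - t ∈ Icc (0:ℝ) L := ⟨by linarith [h.2], by linarith [h.1]⟩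
    rw [indicator_of_mem h', indicator_of_mem h]
  · have h' : x - t ∉ Icc (0:ℝ) L := fun h' => h ⟨by linarith [h'.2], by linarith [h'.1]⟩
    rw [indicator_of_notMem h', indicator_of_notMem h]

/-- The box–box overlap integrand is the indicator of the overlap. [folklore] -/
theorem boxC_mul_boxC_sub (ρ x t : ℝ) :
    boxC ρ t * boxC (1 - ρ) (x - t) = (Icc (0:ℝ) ρ ∩ Icc (x - (1 - ρ)) x).indicator (fun _ => (1:ℂ)) t := by
  rw [boxC_sub]
  unfold boxC
  by_cases h1 : t ∈ Icc (0:ℝ) ρ <;> by_cases h2 : t ∈ Icc (x - (1 - ρ)) x <;>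
    simp [h1, h2, mem_inter_iff]

/-- The box–box overlap has length `max (min ρ x − max 0 (x − (1−ρ))) 0`. [folklore] -/
theorem integral_boxC_mul_boxC_sub (ρ x : ℝ) :
    ∫ t, boxC ρ t * boxC (1 - ρ) (x - t) = ((max (min ρ x - max 0 (x - (1 - ρ))) 0 : ℝ) : ℂ) := by
  have h : (fun t => boxC ρ t * boxC (1 - ρ) (x - t)) =
      (Icc (0:ℝ) ρ ∩ Icc (x - (1 - ρ)) x).indicator (fun _ => (1:ℂ)) := funext (boxC_mul_boxC_sub ρ x)
  rw [h, integral_indicator_const (1:ℂ) (measurableSet_Icc.inter measurableSet_Icc), Icc_inter_Icc,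
    Real.volume_real_Icc, Complex.real_smul, mul_one]

/-- The overlap length IS `ρ ×` the unit ramp profile (`0 < ρ ≤ 1/2`). [folklore] -/
theorem trapezoid_eq_overlap {ρ : ℝ} (hρ : 0 < ρ) (hρ2 : ρ ≤ 1 / 2) (x : ℝ) :
    ρ * LatticeShear.LatticeWord.trapezoid 0 1 ρ x = max (min ρ x - max 0 (x - (1 - ρ))) 0 := by
  unfold LatticeShear.LatticeWord.trapezoid
  rw [sub_zero, mul_one, zero_add]
  -- both sides equal `max 0 (min ρ (min x (1 - x)))`
  have lhs : ρ * max 0 (min 1 (min (x / ρ) ((1 - x) / ρ))) = max 0 (min ρ (min x (1 - x))) := by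
    rw [mul_max_of_nonneg _ _ hρ.le, mul_zero, mul_min_of_nonneg _ _ hρ.le, mul_one, mul_min_of_nonneg _ _ hρ.le,
      mul_div_cancel₀ _ hρ.ne', mul_div_cancel₀ _ hρ.ne']
  rw [lhs]
  rcases le_or_gt x (1 - ρ) with h | h
  · have e1 : max 0 (x - (1 - ρ)) = 0 := max_eq_left (by linarith)
    have e2 : min ρ (min x (1 - x)) = min ρ x := by
      rw [← min_assoc]
      exact min_eq_left (le_trans (min_le_left _ _) (by linarith))
    rw [e1, e2, sub_zero, max_comm]
  · have e1 : max 0 (x - (1 - ρ)) = x - (1 - ρ) := max_eq_right (by linarith)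
    have e2 : min ρ x = ρ := min_eq_left (by linarith)
    have e3 : min ρ (min x (1 - x)) = 1 - x := by
      rw [min_eq_right (by linarith : 1 - x ≤ x)]
      exact min_eq_right (by linarith)
    rw [e1, e2, e3, max_comm]
    congr 1
    ring

/-- The unit ramp profile as a complex-valued function. [folklore] -/
noncomputable def trapC (ρ : ℝ) : ℝ → ℂ := fun s => ((LatticeShear.LatticeWord.trapezoid 0 1 ρ s : ℝ) : ℂ)

/-- **The ramp profile is a box convolution**: `a = ρ⁻¹ · 𝟙_{[0,ρ]} ⋆ 𝟙_{[0,1−ρ]}` (`0 < ρ ≤ 1/2`). [folklore] -/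
theorem trapC_eq_smul_conv {ρ : ℝ} (hρ : 0 < ρ) (hρ2 : ρ ≤ 1 / 2) :
    trapC ρ = (ρ⁻¹ : ℂ) • (boxC ρ ⋆[ContinuousLinearMap.mul ℂ ℂ, volume] boxC (1 - ρ)) := by
  funext x
  rw [Pi.smul_apply, convolution_def]
  simp_rw [ContinuousLinearMap.mul_apply']
  rw [integral_boxC_mul_boxC_sub, ← trapezoid_eq_overlap hρ hρ2, trapC, smul_eq_mul]
  have hρ' : (ρ : ℂ) ≠ 0 := Complex.ofReal_ne_zero.2 hρ.ne'
  push_cast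
  field_simp

/-- The ramp profile is continuous with support in `[0, 1]`, hence integrable. [folklore] -/
theorem integrable_trapC {ρ : ℝ} (hρ : 0 < ρ) : Integrable (trapC ρ) := by
  have hc : Continuous (trapC ρ) := Complex.continuous_ofReal.comp (continuous_trapezoid_unit ρ)
  refine hc.integrable_of_hasCompactSupport
    (HasCompactSupport.intro (K := Icc (0:ℝ) 1) isCompact_Icc fun x (hx : x ∉ Icc (0:ℝ) 1) => ?_)
  simp only [trapC, Complex.ofReal_eq_zero]
  rcases lt_or_gt_of_ne (show x ≠ 0 from fun h => hx (by rw [h]; exact ⟨le_refl 0, zero_le_one⟩)) with h0 | h0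
  · exact trapezoid_unit_eq_zero_of_nonpos hρ h0.le
  · by_cases h1 : 1 ≤ x
    · exact trapezoid_unit_eq_zero_of_one_le hρ h1
    · exact absurd ⟨h0.le, (not_le.1 h1).le⟩ hx

/-- **The autocorrelation is the autoconvolution** `A = a ⋆ a(−·)` (as complex functions on `ℝ`). [folklore] -/
theorem rampAutocorr_eq_conv {ρ : ℝ} (hρ : 0 < ρ) (u : ℝ) :
    ((rampAutocorr ρ u : ℝ) : ℂ) = (trapC ρ ⋆[ContinuousLinearMap.mul ℂ ℂ, volume] (fun s => trapC ρ (-s))) u := by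
  rw [convolution_def]
  simp_rw [ContinuousLinearMap.mul_apply', neg_sub]
  have h : (fun t => trapC ρ t * trapC ρ (t - u)) = (Icc (0:ℝ) 1).indicator (fun t => trapC ρ t * trapC ρ (t - u)) := by
    funext t
    by_cases ht : t ∈ Icc (0:ℝ) 1
    · rw [indicator_of_mem ht]
    · rw [indicator_of_notMem ht]
      have hz : LatticeShear.LatticeWord.trapezoid 0 1 ρ t = 0 := by
        rcases lt_or_ge t 0 with h0 | h0
        · exact trapezoid_unit_eq_zero_of_nonpos hρ h0.le
        · exact trapezoid_unit_eq_zero_of_one_le hρ (le_of_lt (not_le.1 fun h1 => ht ⟨h0, h1⟩))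
      simp [trapC, hz]
  rw [h, integral_indicator measurableSet_Icc, integral_Icc_eq_integral_Ioc, ← intervalIntegral.integral_of_le zero_le_one,
    rampAutocorr]
  simp only [trapC]
  simp_rw [← Complex.ofReal_mul]
  rw [intervalIntegral.integral_ofReal]

/-- `𝓕 (c · g) = c · 𝓕 g` (scalar `c : ℂ`). [folklore] -/
theorem fourier_const_smul' (c : ℂ) (g : ℝ → ℂ) (ξ : ℝ) : 𝓕 (c • g) ξ = c * 𝓕 g ξ := by
  rw [Real.fourier_real_eq, Real.fourier_real_eq, ← integral_const_mul]
  congr 1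
  funext v
  rw [Pi.smul_apply, smul_eq_mul, Circle.smul_def, Circle.smul_def]
  ring

/-- `𝓕 a = ρ⁻¹ · 𝓕 𝟙_{[0,ρ]} · 𝓕 𝟙_{[0,1−ρ]}`. [folklore] -/
theorem fourier_trapC {ρ : ℝ} (hρ : 0 < ρ) (hρ2 : ρ ≤ 1 / 2) (ξ : ℝ) :
    𝓕 (trapC ρ) ξ = (ρ⁻¹ : ℂ) * (𝓕 (boxC ρ) ξ * 𝓕 (boxC (1 - ρ)) ξ) := by
  rw [trapC_eq_smul_conv hρ hρ2, fourier_const_smul',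
    Real.fourier_mul_convolution_eq (integrable_boxC ρ) (integrable_boxC (1 - ρ)) ξ]

/-- `𝓕 (a(−·))(ξ) = 𝓕 a (−ξ)`. [folklore] -/
theorem fourier_trapC_flip (ρ ξ : ℝ) : 𝓕 (fun s => trapC ρ (-s)) ξ = 𝓕 (trapC ρ) (-ξ) := by
  rw [← Real.fourierInv_eq_fourier_neg, Real.fourierInv_eq_fourier_comp_neg]

/-- The explicit spectral density of the ramp autocorrelation in Mathlib's `𝓕` normalisation:
`sin²(πρξ) sin²(π(1−ρ)ξ) / (ρ²π⁴ξ⁴)` (`= slotSpec ρ (2πξ)`). [folklore] -/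
noncomputable def trapSpec (ρ ξ : ℝ) : ℝ :=
  Real.sin (π * ρ * ξ) ^ 2 * Real.sin (π * (1 - ρ) * ξ) ^ 2 / (ρ ^ 2 * π ^ 4 * ξ ^ 4)

/-- The autocorrelation as a complex-valued function. [folklore] -/
noncomputable def rampAutocorrC (ρ : ℝ) : ℝ → ℂ := fun u => ((rampAutocorr ρ u : ℝ) : ℂ)

/-- **`𝓕 A = |𝓕 a|²` explicitly**: `𝓕 A(ξ) = sin²(πρξ) sin²(π(1−ρ)ξ)/(ρ²π⁴ξ⁴)` for `ξ ≠ 0` (`0 < ρ ≤ 1/2`). [folklore] -/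
theorem fourier_rampAutocorrC {ρ : ℝ} (hρ : 0 < ρ) (hρ2 : ρ ≤ 1 / 2) {ξ : ℝ} (hξ : ξ ≠ 0) :
    𝓕 (rampAutocorrC ρ) ξ = ((trapSpec ρ ξ : ℝ) : ℂ) := by
  have hA : rampAutocorrC ρ = trapC ρ ⋆[ContinuousLinearMap.mul ℂ ℂ, volume] (fun s => trapC ρ (-s)) :=
    funext (rampAutocorr_eq_conv hρ)
  rw [hA, Real.fourier_mul_convolution_eq (integrable_trapC hρ) ((integrable_trapC hρ).comp_neg) ξ,
    fourier_trapC_flip, fourier_trapC hρ hρ2, fourier_trapC hρ hρ2]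
  have h1 := fourier_boxC_mul_neg hρ.le hξ
  have h2 := fourier_boxC_mul_neg (by linarith : (0:ℝ) ≤ 1 - ρ) hξ
  have hρ' : (ρ : ℂ) ≠ 0 := Complex.ofReal_ne_zero.2 hρ.ne'
  calc (ρ⁻¹ : ℂ) * (𝓕 (boxC ρ) ξ * 𝓕 (boxC (1 - ρ)) ξ) * ((ρ⁻¹ : ℂ) * (𝓕 (boxC ρ) (-ξ) * 𝓕 (boxC (1 - ρ)) (-ξ)))
      = (ρ⁻¹ : ℂ) ^ 2 * ((𝓕 (boxC ρ) ξ * 𝓕 (boxC ρ) (-ξ)) * (𝓕 (boxC (1 - ρ)) ξ * 𝓕 (boxC (1 - ρ)) (-ξ))) := by ring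
    _ = ((trapSpec ρ ξ : ℝ) : ℂ) := by
      rw [h1, h2, trapSpec]
      push_cast
      field_simp

end FourierSide

/-! ## §13 Fourier inversion: `A(u) = ∫ cos(2πξu)·trapSpec(ξ) dξ = (1/π)∫₀^∞ slotSpec(η) cos(ηu) dη` -/

section Inversion

open scoped FourierTransform Convolution Real

/-- `trapSpec ρ ξ ≥ 0`. [folklore] -/
theorem trapSpec_nonneg (ρ ξ : ℝ) : 0 ≤ trapSpec ρ ξ := by unfold trapSpec; positivity

/-- The majorant `trapSpec ≤ 2(1 + ξ²)⁻¹` (`0 < ρ ≤ 1`). [folklore] -/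
theorem trapSpec_le {ρ : ℝ} (hρ : 0 < ρ) (hρ1 : ρ ≤ 1) (ξ : ℝ) : trapSpec ρ ξ ≤ 2 * (1 + ξ ^ 2)⁻¹ := by
  unfold trapSpec
  rcases eq_or_ne ξ 0 with h0 | h0
  · subst h0; norm_num
  have h1 : Real.sin (π * ρ * ξ) ^ 2 ≤ (π * ρ * ξ) ^ 2 := Real.sin_sq_le_sq
  have h2 : Real.sin (π * (1 - ρ) * ξ) ^ 2 ≤ (π * (1 - ρ) * ξ) ^ 2 := Real.sin_sq_le_sq
  have h3 : Real.sin (π * (1 - ρ) * ξ) ^ 2 ≤ 1 := Real.sin_sq_le_one _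
  have hπ : 1 ≤ π := by linarith [Real.pi_gt_three]
  have hξ2 : 0 < ξ ^ 2 := by positivity
  have hD : 0 < ρ ^ 2 * π ^ 4 * ξ ^ 4 := by positivity
  rw [div_le_iff₀ hD, ← div_eq_mul_inv, div_mul_eq_mul_div, le_div_iff₀ (by positivity)]
  -- sin₁² sin₂² (1 + ξ²) ≤ 2 ρ²π⁴ξ⁴
  have hs2 : Real.sin (π * (1 - ρ) * ξ) ^ 2 * (1 + ξ ^ 2) ≤ 2 * (π ^ 2 * ξ ^ 2) := by
    have a1 : Real.sin (π * (1 - ρ) * ξ) ^ 2 ≤ π ^ 2 * ξ ^ 2 := by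
      calc Real.sin (π * (1 - ρ) * ξ) ^ 2 ≤ (π * (1 - ρ) * ξ) ^ 2 := h2
        _ = (1 - ρ) ^ 2 * (π ^ 2 * ξ ^ 2) := by ring
        _ ≤ 1 * (π ^ 2 * ξ ^ 2) := by
          apply mul_le_mul_of_nonneg_right _ (by positivity)
          nlinarith
        _ = π ^ 2 * ξ ^ 2 := one_mul _
    have a2 : Real.sin (π * (1 - ρ) * ξ) ^ 2 * ξ ^ 2 ≤ π ^ 2 * ξ ^ 2 := by
      calc Real.sin (π * (1 - ρ) * ξ) ^ 2 * ξ ^ 2 ≤ 1 * ξ ^ 2 := mul_le_mul_of_nonneg_right h3 hξ2.le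
        _ ≤ π ^ 2 * ξ ^ 2 := by apply mul_le_mul_of_nonneg_right _ hξ2.le; nlinarith
    nlinarith
  calc Real.sin (π * ρ * ξ) ^ 2 * Real.sin (π * (1 - ρ) * ξ) ^ 2 * (1 + ξ ^ 2)
      = Real.sin (π * ρ * ξ) ^ 2 * (Real.sin (π * (1 - ρ) * ξ) ^ 2 * (1 + ξ ^ 2)) := by ring
    _ ≤ (π * ρ * ξ) ^ 2 * (2 * (π ^ 2 * ξ ^ 2)) :=
        mul_le_mul h1 hs2 (by positivity) (by positivity)
    _ = 2 * (ρ ^ 2 * π ^ 4 * ξ ^ 4) := by ring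

/-- `trapSpec ρ` is measurable. [folklore] -/
theorem measurable_trapSpec (ρ : ℝ) : Measurable (fun ξ : ℝ => trapSpec ρ ξ) := by
  unfold trapSpec
  fun_prop

/-- The spectral density is integrable. [folklore] -/
theorem integrable_trapSpec {ρ : ℝ} (hρ : 0 < ρ) (hρ1 : ρ ≤ 1) : Integrable (fun ξ : ℝ => trapSpec ρ ξ) := by
  refine Integrable.mono' (integrable_inv_one_add_sq.const_mul 2) (measurable_trapSpec ρ).aestronglyMeasurable
    (Filter.Eventually.of_forall fun ξ => ?_)
  rw [Real.norm_eq_abs, abs_of_nonneg (trapSpec_nonneg ρ ξ)]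
  exact trapSpec_le hρ hρ1 ξ

/-- The complexified autocorrelation is continuous. [folklore] -/
theorem continuous_rampAutocorrC (ρ : ℝ) : Continuous (rampAutocorrC ρ) :=
  Complex.continuous_ofReal.comp (continuous_rampAutocorr ρ)

/-- The complexified autocorrelation is integrable (`ρ > 0`). [folklore] -/
theorem integrable_rampAutocorrC {ρ : ℝ} (hρ : 0 < ρ) : Integrable (rampAutocorrC ρ) := by
  have hA : rampAutocorrC ρ = trapC ρ ⋆[ContinuousLinearMap.mul ℂ ℂ, volume] (fun s => trapC ρ (-s)) :=
    funext (rampAutocorr_eq_conv hρ)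
  rw [hA]
  exact (integrable_trapC hρ).integrable_convolution _ ((integrable_trapC hρ).comp_neg)

/-- `𝓕 A = trapSpec` almost everywhere. [folklore] -/
theorem fourier_rampAutocorrC_ae {ρ : ℝ} (hρ : 0 < ρ) (hρ2 : ρ ≤ 1 / 2) :
    𝓕 (rampAutocorrC ρ) =ᵐ[volume] fun ξ => ((trapSpec ρ ξ : ℝ) : ℂ) := by
  have h : ({(0:ℝ)}ᶜ : Set ℝ) ∈ ae (volume : Measure ℝ) := compl_mem_ae_iff.2 (measure_singleton 0)
  filter_upwards [h] with ξ hξ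
  exact fourier_rampAutocorrC hρ hρ2 (by simpa using hξ)

/-- `𝓕` of the complexified autocorrelation is integrable (`0 < ρ ≤ 1/2`). [folklore] -/
theorem integrable_fourier_rampAutocorrC {ρ : ℝ} (hρ : 0 < ρ) (hρ2 : ρ ≤ 1 / 2) :
    Integrable (𝓕 (rampAutocorrC ρ)) :=
  ((integrable_trapSpec hρ (by linarith)).ofReal).congr (fourier_rampAutocorrC_ae hρ hρ2).symm

/-- **FOURIER INVERSION for the ramp autocorrelation**: `A(u) = ∫_ℝ cos(2πξu)·trapSpec ρ ξ dξ` (`0 < ρ ≤ 1/2`, all `u`). [folklore] -/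
theorem rampAutocorr_eq_integral_trapSpec {ρ : ℝ} (hρ : 0 < ρ) (hρ2 : ρ ≤ 1 / 2) (u : ℝ) :
    rampAutocorr ρ u = ∫ ξ, Real.cos (2 * π * (ξ * u)) * trapSpec ρ ξ := by
  have hinv := congrFun ((continuous_rampAutocorrC ρ).fourierInv_fourier_eq (integrable_rampAutocorrC hρ)
    (integrable_fourier_rampAutocorrC hρ hρ2)) u
  have h1 : (𝓕⁻ (𝓕 (rampAutocorrC ρ)) : ℝ → ℂ) u =
      ∫ ξ, Complex.exp (↑(2 * π * (ξ * u)) * Complex.I) * ((trapSpec ρ ξ : ℝ) : ℂ) := by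
    rw [Literature.Analysis.Fourier.fourierInv_real_eq]
    refine integral_congr_ae ?_
    filter_upwards [fourier_rampAutocorrC_ae hρ hρ2] with ξ hξ
    rw [hξ, Circle.smul_def, Real.fourierChar_apply, smul_eq_mul]
  have hint : Integrable (fun ξ : ℝ => Complex.exp (↑(2 * π * (ξ * u)) * Complex.I) * ((trapSpec ρ ξ : ℝ) : ℂ)) := by
    refine ((integrable_trapSpec hρ (by linarith)).ofReal).bdd_mul (c := 1) ?_ (Filter.Eventually.of_forall fun ξ => ?_)
    · exact (Complex.continuous_exp.comp ((Complex.continuous_ofReal.comp (by fun_prop)).mul continuous_const)).aestronglyMeasurable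
    · rw [Complex.norm_exp_ofReal_mul_I]
  have h2 : (∫ ξ, Complex.exp (↑(2 * π * (ξ * u)) * Complex.I) * ((trapSpec ρ ξ : ℝ) : ℂ)).re =
      ∫ ξ, Real.cos (2 * π * (ξ * u)) * trapSpec ρ ξ := by
    have h := integral_re hint
    simp only [RCLike.re_to_complex] at h
    rw [← h]
    refine integral_congr_ae (Filter.Eventually.of_forall fun ξ => ?_)
    show (Complex.exp (↑(2 * π * (ξ * u)) * Complex.I) * ↑(trapSpec ρ ξ)).re = Real.cos (2 * π * (ξ * u)) * trapSpec ρ ξ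
    rw [Complex.re_mul_ofReal, Complex.exp_ofReal_mul_I_re]
  calc rampAutocorr ρ u = (rampAutocorrC ρ u).re := by simp [rampAutocorrC]
    _ = ((𝓕⁻ (𝓕 (rampAutocorrC ρ)) : ℝ → ℂ) u).re := by rw [hinv]
    _ = ∫ ξ, Real.cos (2 * π * (ξ * u)) * trapSpec ρ ξ := by rw [h1, h2]

/-- The slot spectral weight in the `η = 2πξ` normalisation: `Â_ρ(η) = 16 sin²(ρη/2) sin²((1−ρ)η/2)/(ρ²η⁴)`. -/
noncomputable def slotSpec (ρ ξ : ℝ) : ℝ := 16 * Real.sin (ρ * ξ / 2) ^ 2 * Real.sin ((1 - ρ) * ξ / 2) ^ 2 / (ρ ^ 2 * ξ ^ 4)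

/-- `slotSpec ρ ξ ≥ 0`. [folklore] -/
theorem slotSpec_nonneg (ρ ξ : ℝ) : 0 ≤ slotSpec ρ ξ := by unfold slotSpec; positivity

/-- `slotSpec ρ (2πξ) = trapSpec ρ ξ`. [folklore] -/
theorem slotSpec_two_pi_mul (ρ ξ : ℝ) : slotSpec ρ (2 * π * ξ) = trapSpec ρ ξ := by
  unfold slotSpec trapSpec
  rw [show ρ * (2 * π * ξ) / 2 = π * ρ * ξ by ring, show (1 - ρ) * (2 * π * ξ) / 2 = π * (1 - ρ) * ξ by ring,
    show ρ ^ 2 * (2 * π * ξ) ^ 4 = 16 * (ρ ^ 2 * π ^ 4 * ξ ^ 4) by ring, mul_assoc (16:ℝ),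
    mul_div_mul_left _ _ (by norm_num : (16:ℝ) ≠ 0)]

/-- **THE COSINE REPRESENTATION**: `A(u) = (1/π)∫₀^∞ Â_ρ(η) cos(ηu) dη` (`0 < ρ ≤ 1/2`, all `u`). [folklore] -/
theorem rampAutocorr_eq_slotSpec_integral {ρ : ℝ} (hρ : 0 < ρ) (hρ2 : ρ ≤ 1 / 2) (u : ℝ) :
    rampAutocorr ρ u = 1 / π * ∫ η in Ioi (0:ℝ), slotSpec ρ η * Real.cos (η * u) := by
  rw [rampAutocorr_eq_integral_trapSpec hρ hρ2]
  have hev : (fun ξ : ℝ => Real.cos (2 * π * (ξ * u)) * trapSpec ρ ξ) =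
      fun ξ : ℝ => Real.cos (2 * π * (|ξ| * u)) * trapSpec ρ |ξ| := by
    funext ξ
    rcases le_or_gt 0 ξ with h | h
    · rw [abs_of_nonneg h]
    · rw [abs_of_neg h]
      unfold trapSpec
      rw [show 2 * π * (-ξ * u) = -(2 * π * (ξ * u)) by ring, Real.cos_neg,
        show π * ρ * -ξ = -(π * ρ * ξ) by ring, show π * (1 - ρ) * -ξ = -(π * (1 - ρ) * ξ) by ring,
        Real.sin_neg, Real.sin_neg, neg_sq, neg_sq, show (-ξ) ^ 4 = ξ ^ 4 by ring]
  rw [hev, integral_comp_abs (f := fun ξ : ℝ => Real.cos (2 * π * (ξ * u)) * trapSpec ρ ξ)]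
  have hg : (fun ξ : ℝ => Real.cos (2 * π * (ξ * u)) * trapSpec ρ ξ) =
      fun ξ : ℝ => (fun η : ℝ => slotSpec ρ η * Real.cos (η * u)) (2 * π * ξ) := by
    funext ξ
    simp only
    rw [slotSpec_two_pi_mul, mul_comm, show 2 * π * ξ * u = 2 * π * (ξ * u) by ring]
  rw [hg, integral_comp_mul_left_Ioi (fun η : ℝ => slotSpec ρ η * Real.cos (η * u)) 0 (by positivity : (0:ℝ) < 2 * π),
    mul_zero, smul_eq_mul]
  have hπ : (π : ℝ) ≠ 0 := Real.pi_ne_zero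
  have key : ∀ I : ℝ, 2 * ((2 * π)⁻¹ * I) = 1 / π * I := fun I => by field_simp
  exact key _

end Inversion

end Summit.AnomalousDissipation.AnomalousDissipation.Theorems.SolenoidalFractalHomogenisation.LagrangianStep.OddGain
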